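import Summits.NavierStokesRegularity.NavierStokesRegularity.Theorems.LerayQuarterDissipationEnstrophyQuarterLawOfSummit
import HarnessLib

/-!
# ONE QUARTER DECK — the residual `EnstrophyQuarterLaw` (stmt-1574) is EXACTLY the pair
# `NoTypeII ∧ QuarterLawTypeI` (stmt-0056 ∧ stmt-23726), and the two quarter routes share one deck

Writer port (decomp-ns-writer-1 g9) of decomp-ns lens 3, generation 23, `OneQuarterDeckG23.lean` (sha256 4f09ea8a…;
CRITIC-LEDGER row 274 CLEARED (KERNEL): «EQL 1574 ≡ NoTypeII 0056 ∧ K1 23726 (two EXISTING items) … optional landing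
Theorems/LerayQuarterDissipationQuarterDeck.lean --supports 1574 — no objection (edges only)»).  Helper for route
`LerayQuarterDissipation`'s residual crux `EnstrophyQuarterLaw` (stmt-NavierStokesRegularity-1574); NO item is closed,
Navier–Stokes regularity is NOT proved by anything here.  No new definitions, no type-class declarations, no notation.

PORT RULE (cell pattern of record, writer g7/g8): a certificate relating OPEN route items is landed as an `Iff` / `TFAE`
(or an `Iff` under hypotheses), never as a theorem whose head is an open item or the summit.  So the lens's one-way edges
`EQL → K1`, `EQL → NoTypeII`, `NoTypeII → K1 → EQL`, `S → K1`, `S → NoTypeII` are folded into the `Iff`s below, and its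
summit-headed packagings (`navierStokesRegularity_of_quarterDeck`, `closes_typeIQuarterGate_via_lqd`,
`closes_via_typeIAncientLiouville`, `closes_via_liouvilleConjectureNS`, `navierStokesRegularity_of_quarterDeck_texts`) are
re-typed as `<Liouville back end> → (S ↔ NoTypeII ∧ K1)`.  Receipts (§0) and the `Iff`/`TFAE` theorems are verbatim.

THE POINT (lens docstring, abridged).  Route `LerayQuarterDissipation` (LQD, rev 6) decides Clay (A) from its residual
`EnstrophyQuarterLaw` (EQL, stmt-1574) and its blocker `FiniteDissipationLiouville` (FDL, stmt-22144), the supports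
`RecordTimeTypeI` / `DissipativeZoom` being PROVED (`…SummitEdge.navierStokesRegularity_iff_enstrophyQuarterLaw_of_fdl`).
Route `TypeIQuarterGate` (TIQG) decides Clay (A) from `QuarterLawTypeI` (K1, stmt-23726) ∧ `ParabolicGaldiLiouville`
(stmt-0893) ∧ `NoTypeII` (stmt-0056), its support `QuarterZoom` being PROVED.  This file certifies:

* `enstrophyQuarterLaw_iff_noTypeII_and_quarterLawTypeI` — **EQL ⟺ NoTypeII ∧ K1**, EXACT: `→` is the landed
  record-time capacity lemma (`…Links.noTypeII_of_enstrophyQuarterLaw`: enstrophy quarter law ⇒ velocity Type-I rate)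
  plus the trivial weakening; `←` is one line of logic (under NoTypeII every blow-up is Type I, and K1 is the quarter law
  on Type-I blow-ups).  So the lineage's «residual of record» EQL is not a third statement beside TIQG's two cruxes: it
  IS their conjunction, by name.
* `navierStokesRegularity_iff_noTypeII_and_quarterLawTypeI_of_fdl` — under FDL, **Clay (A) ⟺ NoTypeII ∧ K1** (the ONE
  deck both routes stand on); the same under the other Liouville back ends through the landed edges 0893 ⇒ FDL
  (`…OfGaldi.finiteDissipationLiouville_of_parabolicGaldiLiouville'`), 4050 ⇒ FDL
  (`…Links.finiteDissipationLiouville_of_typeIAncientLiouville'`) and (L) `LiouvilleConjectureNS`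
  (`…SummitEdge.navierStokesRegularity_iff_enstrophyQuarterLaw_of_liouvilleConjectureNS`).  Reading: LQD ⊑ TIQG ⊑
  {K1, NoTypeII, 4050} — the decks differ ONLY in the Liouville back end.
* `navierStokesRegularity_iff_and_fronts` — both front statements are CONSEQUENCES of the summit (vacuity through
  `…SummitEdge.enstrophyQuarterLaw_of_navierStokesRegularity`), so neither is stronger than (A); hence under FDL each
  front statement is EQUIVALENT to the summit given the other.

Census consequence (honest): the lens-3 residual row «EQL 1574 (Tao-LOADED)» folds into shelf [B] (Type-II exclusion,
`NoTypeII` 0056 — the hard core shared by ≥ 9 routes) plus TIQG's attacked crux K1 (23726, with its own booked split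
FiniteScarsTypeI ∧ ScarEnvelopeTypeI ∧ EnvelopeQuarterLaw); what is PROPER to the lineage is the blocker FDL alone
(= W 29252 ∧ past-wandering, tree `finiteDissipationLiouville_iff_wall_and_pastWandering`).  Rung 0.
-/

noncomputable section

-- the summit and its single sub-problem share the name (CONVENTIONS §1), as in every Theorems file
set_option linter.dupNamespace false

namespace Summit.NavierStokesRegularity.NavierStokesRegularity.Theorems.QuarterDeck

open MeasureTheory Literature.Analysis Literature.Analysis.FluidPDE
open Summit.NavierStokesRegularity.NavierStokesRegularity.Theorems.FiniteDissipationLiouville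

/-! ### §0 Receipts: the REGISTERED ledger texts are the decls used below (fetched 2026-08-30T20:2xZ,
`ledger workitem get stmt-NavierStokesRegularity-<id> --json`, payload.signature verbatim) -/

/-- Registered text of stmt-NavierStokesRegularity-1574 (EQL, `EnstrophyQuarterLaw`) ↔ the decl `Theses.LerayQuarterDissipation.EnstrophyQuarterLaw`. -/
theorem text_1574_iff :
    (∀ (ν T : ℝ), 0 < ν → 0 < T → ∀ (u : ℝ → EuclideanSpace ℝ (Fin 3) → EuclideanSpace ℝ (Fin 3)) (p : ℝ → EuclideanSpace ℝ (Fin 3) → ℝ), Literature.Analysis.FluidPDE.IsMaximalSmoothSolution ν 0 u p T → Literature.Analysis.FluidPDE.IsLerayHopfOn T ν 0 (u 0) u → Literature.Analysis.FluidPDE.HasRapidSpatialDecay (u 0) → ∃ K : ℝ, ∀ t ∈ Set.Ico 0 T, ∫⁻ x, ‖Literature.Analysis.FluidPDE.curl (u t) x‖ₑ ^ 2 ≤ ENNReal.ofReal (K / Real.sqrt (T - t))) ↔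
      Theses.LerayQuarterDissipation.EnstrophyQuarterLaw :=
  Iff.rfl

/-- Registered text of stmt-NavierStokesRegularity-0056 (`NoTypeII`) ↔ the decl `Theses.TypeIQuarterGate.NoTypeII`. -/
theorem text_0056_iff :
    (∀ (ν T : ℝ), 0 < ν → 0 < T → ∀ (u : ℝ → EuclideanSpace ℝ (Fin 3) → EuclideanSpace ℝ (Fin 3)) (p : ℝ → EuclideanSpace ℝ (Fin 3) → ℝ), Literature.Analysis.FluidPDE.IsMaximalSmoothSolution ν 0 u p T → Literature.Analysis.FluidPDE.IsLerayHopfOn T ν 0 (u 0) u → Literature.Analysis.FluidPDE.HasRapidSpatialDecay (u 0) → Literature.Analysis.FluidPDE.IsTypeIBlowup u T) ↔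
      Theses.TypeIQuarterGate.NoTypeII :=
  Iff.rfl

/-- Registered text of stmt-NavierStokesRegularity-23726 (K1, `QuarterLawTypeI`) ↔ the decl `Theses.TypeIQuarterGate.QuarterLawTypeI`. -/
theorem text_23726_iff :
    (∀ (ν T : ℝ), 0 < ν → 0 < T → ∀ (u : ℝ → EuclideanSpace ℝ (Fin 3) → EuclideanSpace ℝ (Fin 3)) (p : ℝ → EuclideanSpace ℝ (Fin 3) → ℝ), Literature.Analysis.FluidPDE.IsMaximalSmoothSolution ν 0 u p T → Literature.Analysis.FluidPDE.IsLerayHopfOn T ν 0 (u 0) u → Literature.Analysis.FluidPDE.HasRapidSpatialDecay (u 0) → Literature.Analysis.FluidPDE.IsTypeIBlowup u T → ∃ K : ℝ, ∀ t ∈ Set.Ico 0 T, ∫⁻ x, ‖Literature.Analysis.FluidPDE.curl (u t) x‖ₑ ^ 2 ≤ ENNReal.ofReal (K / Real.sqrt (T - t))) ↔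
      Theses.TypeIQuarterGate.QuarterLawTypeI :=
  Iff.rfl

/-- Registered text of stmt-NavierStokesRegularity-22144 (FDL, `FiniteDissipationLiouville`) ↔ the decl `Theses.LerayQuarterDissipation.FiniteDissipationLiouville`. -/
theorem text_22144_iff :
    (∀ (C K : ℝ) (ū : ℝ → EuclideanSpace ℝ (Fin 3) → EuclideanSpace ℝ (Fin 3)), Literature.Analysis.FluidPDE.IsTypeIAncientMild C ū → (∀ s : ℝ, s < 0 → ∫⁻ x, ‖fderiv ℝ (ū s) x‖ₑ ^ 2 ≤ ENNReal.ofReal (K / Real.sqrt (-s))) → ¬ (∀ r > 0, ∀ M : ℝ, ∃ t ∈ Set.Ioo (-(r ^ 2)) (0 : ℝ), ∃ x ∈ Metric.ball (0 : EuclideanSpace ℝ (Fin 3)) r, M < ‖ū t x‖)) ↔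
      Theses.LerayQuarterDissipation.FiniteDissipationLiouville :=
  Iff.rfl

/-- Registered text of stmt-NavierStokesRegularity-0893 (`ParabolicGaldiLiouville`) ↔ the decl `Theses.TypeIQuarterGate.ParabolicGaldiLiouville`. -/
theorem text_0893_iff :
    (∀ v : ℝ → EuclideanSpace ℝ (Fin 3) → EuclideanSpace ℝ (Fin 3), Literature.Analysis.FluidPDE.IsBoundedAncientMildSolution 1 v → ContDiffOn ℝ (⊤ : ℕ∞) (Function.uncurry v) (Set.Iio 0 ×ˢ Set.univ) → (∃ C : NNReal, ∀ s < 0, ∫⁻ y, ENNReal.ofReal (Literature.Analysis.FluidPDE.frobeniusNormSq (fderiv ℝ (v s) y)) ≤ C) → (∀ s < 0, MeasureTheory.MemLp (v s) 6 MeasureTheory.volume) → ∀ s < 0, ∀ y, v s y = 0) ↔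
      Theses.TypeIQuarterGate.ParabolicGaldiLiouville :=
  Iff.rfl

/-- Registered text of stmt-NavierStokesRegularity-4050 ((L′) `TypeIAncientLiouville`) ↔ the decl `Theses.ExtremalTypeIConstant.TypeIAncientLiouville`. -/
theorem text_4050_iff :
    (∀ (C : ℝ) (u : ℝ → EuclideanSpace ℝ (Fin 3) → EuclideanSpace ℝ (Fin 3)), ContDiffOn ℝ (⊤ : ℕ∞) (Function.uncurry u) (Set.Iio 0 ×ˢ Set.univ) ∧ (∀ t < 0, Literature.Analysis.FluidPDE.VectorCalculus.IsDivFree (u t)) ∧ (∀ s t : ℝ, s < t → t < 0 → ∀ x, u t x = Literature.Analysis.FluidPDE.heatFlow (u s) (t - s) x - ∫ τ in Set.Ioo s t, ∫ y, Literature.Analysis.FluidPDE.oseenKernel (t - τ) (x - y) (u τ y) (u τ y)) ∧ Literature.Analysis.FluidPDE.HasTypeITimeDecay C u → ∀ t < 0, ∀ x, u t x = 0) ↔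
      Theses.ExtremalTypeIConstant.TypeIAncientLiouville :=
  Iff.rfl

/-! ### Receipts (continued): the copies of the shared texts agree definitionally -/

/-- The two copies of `NoTypeII` (stmt-0056) in routes `TypeIQuarterGate` and `AdaptedFrequency`
are the same statement. -/
theorem noTypeII_typeIQuarterGate_iff_adaptedFrequency :
    Theses.TypeIQuarterGate.NoTypeII ↔ Theses.AdaptedFrequency.NoTypeII := Iff.rfl

/-- The two copies of `ParabolicGaldiLiouville` (stmt-0893) in routes `TypeIQuarterGate` and
`GaldiLiouvilleGate` are the same statement. -/
theorem parabolicGaldiLiouville_typeIQuarterGate_iff_galdiLiouvilleGate :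
    Theses.TypeIQuarterGate.ParabolicGaldiLiouville ↔ Theses.GaldiLiouvilleGate.ParabolicGaldiLiouville :=
  Iff.rfl


/-! ### §1 The residual is exactly the pair -/

/-- **THE RESIDUAL IS THE PAIR.** `EnstrophyQuarterLaw` (stmt-1574) ⟺ `NoTypeII` (stmt-0056) ∧
`QuarterLawTypeI` (stmt-23726): `→` = the landed record-time capacity lemma `Links.noTypeII_of_enstrophyQuarterLaw`
and the trivial weakening; `←` = under NoTypeII every maximal solution of the frame is a Type-I blow-up, on which K1 is
the quarter law. [folklore] -/
theorem enstrophyQuarterLaw_iff_noTypeII_and_quarterLawTypeI :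
    Theses.LerayQuarterDissipation.EnstrophyQuarterLaw ↔
      (Theses.TypeIQuarterGate.NoTypeII ∧ Theses.TypeIQuarterGate.QuarterLawTypeI) :=
  ⟨fun hQ => ⟨Links.noTypeII_of_enstrophyQuarterLaw hQ,
      fun ν T hν hT u p hmax hLH hdec _ => hQ ν T hν hT u p hmax hLH hdec⟩,
    fun h ν T hν hT u p hmax hLH hdec => h.2 ν T hν hT u p hmax hLH hdec (h.1 ν T hν hT u p hmax hLH hdec)⟩

/-- The same against route `AdaptedFrequency`'s copy of `NoTypeII` (the copy the landed edge
`…Links.noTypeII_of_enstrophyQuarterLaw` is stated with). [folklore] -/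
theorem enstrophyQuarterLaw_iff_noTypeII_and_quarterLawTypeI' :
    Theses.LerayQuarterDissipation.EnstrophyQuarterLaw ↔
      (Theses.AdaptedFrequency.NoTypeII ∧ Theses.TypeIQuarterGate.QuarterLawTypeI) :=
  enstrophyQuarterLaw_iff_noTypeII_and_quarterLawTypeI

/-! ### §2 One deck: under a Liouville back end, Clay (A) ⟺ NoTypeII ∧ K1 -/

/-- **Under FDL, Clay (A) ⟺ NoTypeII ∧ K1** — route LQD's deciding theorem (`Theses.LerayQuarterDissipation.closes`
with the PROVED supports, packaged in the tree as `…SummitEdge.navierStokesRegularity_iff_enstrophyQuarterLaw_of_fdl`)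
composed with §1. [folklore] -/
theorem navierStokesRegularity_iff_noTypeII_and_quarterLawTypeI_of_fdl
    (hL : Theses.LerayQuarterDissipation.FiniteDissipationLiouville) :
    _root_.NavierStokesRegularity ↔
      (Theses.TypeIQuarterGate.NoTypeII ∧ Theses.TypeIQuarterGate.QuarterLawTypeI) :=
  (SummitEdge.navierStokesRegularity_iff_enstrophyQuarterLaw_of_fdl hL).trans
    enstrophyQuarterLaw_iff_noTypeII_and_quarterLawTypeI

/-- **TIQG ⊒ LQD.** Under route `TypeIQuarterGate`'s Liouville input `ParabolicGaldiLiouville` (stmt-0893),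
Clay (A) ⟺ NoTypeII ∧ K1 — Galdi's parabolic Liouville statement enters only via the landed edge 0893 ⇒ FDL
(`…OfGaldi.finiteDissipationLiouville_of_parabolicGaldiLiouville'`, the time-shift bridge). [folklore] -/
theorem navierStokesRegularity_iff_noTypeII_and_quarterLawTypeI_of_parabolicGaldiLiouville
    (hP : Theses.TypeIQuarterGate.ParabolicGaldiLiouville) :
    _root_.NavierStokesRegularity ↔
      (Theses.TypeIQuarterGate.NoTypeII ∧ Theses.TypeIQuarterGate.QuarterLawTypeI) :=
  navierStokesRegularity_iff_noTypeII_and_quarterLawTypeI_of_fdl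
    (OfGaldi.finiteDissipationLiouville_of_parabolicGaldiLiouville' hP)

/-- The same deck with the Liouville back end (L′) = `TypeIAncientLiouville` (stmt-4050, route
`ExtremalTypeIConstant`'s copy), through the landed edge 4050 ⇒ FDL. [folklore] -/
theorem navierStokesRegularity_iff_noTypeII_and_quarterLawTypeI_of_typeIAncientLiouville
    (hX : Theses.ExtremalTypeIConstant.TypeIAncientLiouville) :
    _root_.NavierStokesRegularity ↔
      (Theses.TypeIQuarterGate.NoTypeII ∧ Theses.TypeIQuarterGate.QuarterLawTypeI) :=
  navierStokesRegularity_iff_noTypeII_and_quarterLawTypeI_of_fdl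
    (Links.finiteDissipationLiouville_of_typeIAncientLiouville' hX)

/-- The same deck with the Liouville back end (L) = `LiouvilleConjectureNS` (the canonical conjecture leaf),
through the landed chain (L) ⇒ 4050 ⇒ FDL. [folklore] -/
theorem navierStokesRegularity_iff_noTypeII_and_quarterLawTypeI_of_liouvilleConjectureNS
    (hLiou : _root_.Summit.NavierStokesRegularity.NavierStokesRegularity.LiouvilleConjectureNS) :
    _root_.NavierStokesRegularity ↔
      (Theses.TypeIQuarterGate.NoTypeII ∧ Theses.TypeIQuarterGate.QuarterLawTypeI) :=
  (SummitEdge.navierStokesRegularity_iff_enstrophyQuarterLaw_of_liouvilleConjectureNS hLiou).trans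
    enstrophyQuarterLaw_iff_noTypeII_and_quarterLawTypeI

/-! ### §3 Both front statements are consequences of the summit -/

/-- **S ⟺ S ∧ NoTypeII ∧ K1** (certificate form of «S ⟹ NoTypeII» and «S ⟹ K1»: vacuity — under (A) no maximal
classical Leray–Hopf solution from a rapidly decaying datum has finite lifespan; through the landed `S ⟹ EQL`,
`…SummitEdge.enstrophyQuarterLaw_of_navierStokesRegularity`).  Neither front statement is stronger than (A). [folklore] -/
theorem navierStokesRegularity_iff_and_fronts :
    _root_.NavierStokesRegularity ↔
      (_root_.NavierStokesRegularity ∧ Theses.TypeIQuarterGate.NoTypeII ∧ Theses.TypeIQuarterGate.QuarterLawTypeI) :=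
  ⟨fun hA => ⟨hA, enstrophyQuarterLaw_iff_noTypeII_and_quarterLawTypeI.1
      (SummitEdge.enstrophyQuarterLaw_of_navierStokesRegularity hA)⟩, And.left⟩

/-- Hence, under FDL, each front statement is EQUIVALENT to the summit given the other:
**FDL → NoTypeII → (S ⟺ K1)**. [folklore] -/
theorem navierStokesRegularity_iff_quarterLawTypeI_of_fdl_of_noTypeII
    (hL : Theses.LerayQuarterDissipation.FiniteDissipationLiouville)
    (hN : Theses.TypeIQuarterGate.NoTypeII) :
    _root_.NavierStokesRegularity ↔ Theses.TypeIQuarterGate.QuarterLawTypeI :=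
  ⟨fun hA => (navierStokesRegularity_iff_and_fronts.1 hA).2.2,
    fun hK => (navierStokesRegularity_iff_noTypeII_and_quarterLawTypeI_of_fdl hL).2 ⟨hN, hK⟩⟩

/-- **FDL → K1 → (S ⟺ NoTypeII)**: on the quarter deck with K1 granted, the Millennium problem (A) is exactly
Type-II exclusion. [folklore] -/
theorem navierStokesRegularity_iff_noTypeII_of_fdl_of_quarterLawTypeI
    (hL : Theses.LerayQuarterDissipation.FiniteDissipationLiouville)
    (hK : Theses.TypeIQuarterGate.QuarterLawTypeI) :
    _root_.NavierStokesRegularity ↔ Theses.TypeIQuarterGate.NoTypeII :=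
  ⟨fun hA => (navierStokesRegularity_iff_and_fronts.1 hA).2.1,
    fun hN => (navierStokesRegularity_iff_noTypeII_and_quarterLawTypeI_of_fdl hL).2 ⟨hN, hK⟩⟩

/-! ### §4 Bookkeeping summary (pure logic over the above) -/

/-- **ONE QUARTER DECK (summary).** Under FDL the following are equivalent: Clay (A); the residual EQL
(stmt-1574); the pair NoTypeII ∧ K1 (stmt-0056 ∧ stmt-23726). [folklore] -/
theorem quarterDeck_tfae (hL : Theses.LerayQuarterDissipation.FiniteDissipationLiouville) :
    [_root_.NavierStokesRegularity,
      Theses.LerayQuarterDissipation.EnstrophyQuarterLaw,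
      Theses.TypeIQuarterGate.NoTypeII ∧ Theses.TypeIQuarterGate.QuarterLawTypeI].TFAE := by
  tfae_have 1 ↔ 2 := SummitEdge.navierStokesRegularity_iff_enstrophyQuarterLaw_of_fdl hL
  tfae_have 2 ↔ 3 := enstrophyQuarterLaw_iff_noTypeII_and_quarterLawTypeI
  tfae_finish

/-- **THE QUARTER DECK ON THE REGISTERED TEXTS**: under the stmt-22144 text, Clay (A) ⟺ (stmt-0056 text) ∧
(stmt-23726 text), the texts being the ledger signatures verbatim (§0). [folklore] -/
theorem navierStokesRegularity_iff_texts_of_text_22144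
    (hL : ∀ (C K : ℝ) (ū : ℝ → EuclideanSpace ℝ (Fin 3) → EuclideanSpace ℝ (Fin 3)), Literature.Analysis.FluidPDE.IsTypeIAncientMild C ū → (∀ s : ℝ, s < 0 → ∫⁻ x, ‖fderiv ℝ (ū s) x‖ₑ ^ 2 ≤ ENNReal.ofReal (K / Real.sqrt (-s))) → ¬ (∀ r > 0, ∀ M : ℝ, ∃ t ∈ Set.Ioo (-(r ^ 2)) (0 : ℝ), ∃ x ∈ Metric.ball (0 : EuclideanSpace ℝ (Fin 3)) r, M < ‖ū t x‖)) :
    _root_.NavierStokesRegularity ↔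
      ((∀ (ν T : ℝ), 0 < ν → 0 < T → ∀ (u : ℝ → EuclideanSpace ℝ (Fin 3) → EuclideanSpace ℝ (Fin 3)) (p : ℝ → EuclideanSpace ℝ (Fin 3) → ℝ), Literature.Analysis.FluidPDE.IsMaximalSmoothSolution ν 0 u p T → Literature.Analysis.FluidPDE.IsLerayHopfOn T ν 0 (u 0) u → Literature.Analysis.FluidPDE.HasRapidSpatialDecay (u 0) → Literature.Analysis.FluidPDE.IsTypeIBlowup u T) ∧ (∀ (ν T : ℝ), 0 < ν → 0 < T → ∀ (u : ℝ → EuclideanSpace ℝ (Fin 3) → EuclideanSpace ℝ (Fin 3)) (p : ℝ → EuclideanSpace ℝ (Fin 3) → ℝ), Literature.Analysis.FluidPDE.IsMaximalSmoothSolution ν 0 u p T → Literature.Analysis.FluidPDE.IsLerayHopfOn T ν 0 (u 0) u → Literature.Analysis.FluidPDE.HasRapidSpatialDecay (u 0) → Literature.Analysis.FluidPDE.IsTypeIBlowup u T → ∃ K : ℝ, ∀ t ∈ Set.Ico 0 T, ∫⁻ x, ‖Literature.Analysis.FluidPDE.curl (u t) x‖ₑ ^ 2 ≤ ENNReal.ofReal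 (K / Real.sqrt (T - t)))) :=
  (navierStokesRegularity_iff_noTypeII_and_quarterLawTypeI_of_fdl (text_22144_iff.1 hL)).trans
    (Iff.and text_0056_iff.symm text_23726_iff.symm)


/-- **THE RESIDUAL IS THE PAIR, ON THE REGISTERED TEXTS**: stmt-1574 ↔ stmt-0056 ∧ stmt-23726 verbatim. -/
theorem text_1574_iff_text_0056_and_text_23726 :
    (∀ (ν T : ℝ), 0 < ν → 0 < T → ∀ (u : ℝ → EuclideanSpace ℝ (Fin 3) → EuclideanSpace ℝ (Fin 3)) (p : ℝ → EuclideanSpace ℝ (Fin 3) → ℝ), Literature.Analysis.FluidPDE.IsMaximalSmoothSolution ν 0 u p T → Literature.Analysis.FluidPDE.IsLerayHopfOn T ν 0 (u 0) u → Literature.Analysis.FluidPDE.HasRapidSpatialDecay (u 0) → ∃ K : ℝ, ∀ t ∈ Set.Ico 0 T, ∫⁻ x, ‖Literature.Analysis.FluidPDE.curl (u t) x‖ₑ ^ 2 ≤ ENNReal.ofReal (K / Real.sqrt (T - t))) ↔ ((∀ (ν T : ℝ), 0 < ν → 0 < T → ∀ (u : ℝ → EuclideanSpace ℝ (Fin 3)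 → EuclideanSpace ℝ (Fin 3)) (p : ℝ → EuclideanSpace ℝ (Fin 3) → ℝ), Literature.Analysis.FluidPDE.IsMaximalSmoothSolution ν 0 u p T → Literature.Analysis.FluidPDE.IsLerayHopfOn T ν 0 (u 0) u → Literature.Analysis.FluidPDE.HasRapidSpatialDecay (u 0) → Literature.Analysis.FluidPDE.IsTypeIBlowup u T) ∧ (∀ (ν T : ℝ), 0 < ν → 0 < T → ∀ (u : ℝ → EuclideanSpace ℝ (Fin 3) → EuclideanSpace ℝ (Fin 3)) (p : ℝ → EuclideanSpace ℝ (Fin 3) → ℝ), Literature.Analysis.FluidPDE.IsMaximalSmoothSolution ν 0 u p T → Literature.Analysis.FluidPDE.IsLerayHopfOn T ν 0 (u 0) u → Literature.Analysis.FluidPDE.HasRapidSpatialDecay (u 0) → Literature.Analysis.FluidPDE.IsTypeIBlowup u T → ∃ K : ℝ, ∀ t ∈ Set.Ico 0 T, ∫⁻ x, ‖Literature.Analysis.FluidPDE.curl (u t) x‖ₑ ^ 2 ≤ ENNReal.ofReal (K / Real.sqrt (T - t)))) :=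
  text_1574_iff.trans (enstrophyQuarterLaw_iff_noTypeII_and_quarterLawTypeI.trans
    (Iff.and text_0056_iff.symm text_23726_iff.symm))

end Summit.NavierStokesRegularity.NavierStokesRegularity.Theorems.QuarterDeck

end
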